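import Summits.NavierStokesRegularity.NavierStokesRegularity.Theorems.StrainDoorsViscous
import HarnessLib

/-!
# StrainDoorsSpacetimeRecord — THE SPACE-TIME RECORD LAW: every new high of the strain number is expensive

nsreg-p1 g34, ROUND-52 PART 1 (helper lane of `stmt-NavierStokesRegularity-0056`, rung N0; 0 ledger writes by the
planner — text for the S-lane to land `--supports stmt-NavierStokesRegularity-0056 --as helper`).

The strain clock of the lane (doors D1–D12) in POINTWISE form.  Classical solution `(u,p)` on a time set `S` (unique
differentiability, `S ⊆ closure (interior S)`; the lane's frame is `S = [0,T)`), unit direction `e`, point `x`, ANY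
reference time `T`; `q = ⟪∇u(t,x)e,e⟫` (`strainQuad`), `H = ¼(|ω|² − ⟪ω,e⟫²) − ∇²p(e,e)` (`strainFeed`), and the
STRAIN NUMBER DENSITY `N(t,x,e) = (T − t)·q`.

* §0 `strainFrame_on` — plate F_S on a general time set (the lane's `strainFrame_holds` is `S = [0,T)`).
* §1 `spacetime_record_inequality` (`_of_le`) — at a spatially critical point with `(T − t)·∂ₜq = q` (resp. `≥ q`,
  `t ≤ T`):  `N + N² − ν(T − t)²·Δ_x q ≤ (T − t)²·H`  (F_S + E1_S⁺ `strainGrowthViscous_holds`).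
* §2 `hasDerivWithinAt_strainQuad`; Fermat in time for the strain number, two-sided (`strainNumber_fermat`) and
  ONE-SIDED at a left local maximum (`hasDerivAt_nonneg_of_isLocalMaxOn_Iic`, `strainNumber_fermat_left`).
* §3 ★ `spacetime_record_law` / `spacetime_defect_law` — at a space-time record (spatial maximum of `q(t,·,e)` +
  interior local maximum in time of `s ↦ (T − s)·q(s,x,e)`):  `N·(1 + N) ≤ (T − t)²·H`, i.e. `((H − q²)/q²)·N ≥ 1`;
  ★★ `running_record_law` / `running_record_defect_law` — the same at a RUNNING RECORD: `(T − t)·q(t,x,e)` dominates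
  `(T − s)·q(s,y,e')` for all `(y,e')` and all times `s ≤ t` close to `t` (only one-sided Fermat is used).  This is
  door D12's defect–lifespan law (`defect_lifespan_law`, ROUND-50) AT THE RECORDS with constant exactly `1`, no
  smoothing budget, no `e^β`, no finite-energy Sobolev frame, no decay: a theorem about every classical solution.
  `_Ico` forms restate it in the lane's frame `[0,T')` with `strainRate`.
PART 2 (`StrainDoorsSpacetimeRecords`): the records theorem (a rising, attained strain number produces running
records), the peak law for a majorant, the ancient/attained-supremum form, and DSS scaling invariance of `N`.

WHAT THIS IS NOT: not a regularity criterion by itself, not an exclusion of any blow-up or profile; `0056`/NS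
regularity are not proved.  No new definitions; no sorry.
-/

noncomputable section

open MeasureTheory Set Function Filter Metric Real InnerProductSpace
open _root_.Topology
open scoped ENNReal NNReal RealInnerProductSpace ContDiff Laplacian
open Literature.Analysis Literature.Analysis.FluidPDE
open Literature.Analysis.FluidPDE.VorticityDirectionDynamics

set_option linter.dupNamespace false

namespace Summit.NavierStokesRegularity.NavierStokesRegularity.Theorems.StrainDoors

open Summit.NavierStokesRegularity.NavierStokesRegularity.Theorems.ArgmaxDoors

/-! ## §0 The frame identity on a general time set -/

/-- **F_S on a general time set.** For a classical solution on a time set `S` of unique differentiability with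
`S ⊆ closure (interior S)`, at every `t ∈ S`, `x`, `e`:
`∂ₜ(∇u e)(t,x) + D((u·∇)u)(x) e = ν D(Δu)(x) e − D(∇p)(x) e`, `∂ₜ = timeDerivWithin S` (mixed partials commute:
`IsSmoothSpaceTimeOn.timeDerivWithin_fderiv_slice_apply`; then the momentum equation is differentiated along `e`).
The lane's `strainFrame_holds` is the case `S = [0,T)`. [folklore] -/
theorem strainFrame_on {ν : ℝ} {S : Set ℝ}
    {u : ℝ → (EuclideanSpace ℝ (Fin 3)) → (EuclideanSpace ℝ (Fin 3))} {p : ℝ → (EuclideanSpace ℝ (Fin 3)) → ℝ}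
    (hS : UniqueDiffOn ℝ S) (hcl : S ⊆ closure (interior S)) (hsol : IsClassicalNSSolutionOn S ν 0 u p)
    {t : ℝ} (ht : t ∈ S) (x e : EuclideanSpace ℝ (Fin 3)) :
    timeDerivWithin S (fun s y => fderiv ℝ (u s) y e) t x + fderiv ℝ (convect (u t) (u t)) x e
      = ν • fderiv ℝ (Δ (u t)) x e - fderiv ℝ (gradient (p t)) x e := by
  rw [hsol.smooth_velocity.timeDerivWithin_fderiv_slice_apply hS hcl ht x e]
  set w : (EuclideanSpace ℝ (Fin 3)) → (EuclideanSpace ℝ (Fin 3)) := timeDerivWithin S u t with hw_def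
  have hw : ContDiff ℝ ∞ w := (hsol.smooth_velocity.timeDerivWithin hS).contDiff_slice ht
  have hu : ContDiff ℝ ∞ (u t) := hsol.smooth_velocity.contDiff_slice ht
  have hu3 : ContDiff ℝ 3 (u t) := contDiff_infty.1 hu 3
  have hwd : Differentiable ℝ w := (contDiff_infty.1 hw 1).differentiable one_ne_zero
  have hud : Differentiable ℝ (u t) := (contDiff_infty.1 hu 1).differentiable one_ne_zero
  have hDud : Differentiable ℝ (fderiv ℝ (u t)) :=
    ((contDiff_infty.1 hu 2).fderiv_right (m := 1) le_rfl).differentiable one_ne_zero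
  have hΔd : Differentiable ℝ (Δ (u t)) := differentiable_laplacian hu3
  have hcd : Differentiable ℝ (convect (u t) (u t)) := by
    have : convect (u t) (u t) = fun y => fderiv ℝ (u t) y (u t y) := rfl
    rw [this]
    exact hDud.clm_apply hud
  have hgrad : gradient (p t) = fun y => ν • (Δ (u t)) y - w y - convect (u t) (u t) y := by
    funext y
    have hm := hsol.momentum t ht y
    have h0 : (0 : ℝ → (EuclideanSpace ℝ (Fin 3)) → (EuclideanSpace ℝ (Fin 3))) t y = 0 := rfl
    rw [h0, add_zero] at hm
    rw [← sub_eq_zero] at hm ⊢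
    rw [← hm]
    abel
  rw [hgrad]
  have d1 : DifferentiableAt ℝ (fun y => ν • (Δ (u t)) y) x := (hΔd x).const_smul ν
  have d2 : DifferentiableAt ℝ (fun y => ν • (Δ (u t)) y - w y) x := d1.sub (hwd x)
  rw [fderiv_fun_sub d2 (hcd x), fderiv_fun_sub d1 (hwd x), fderiv_fun_const_smul (hΔd x) ν]
  simp only [sub_apply, FunLike.coe_smul, Pi.smul_apply]
  abel

/-! ## §1 The record inequality at a space-time critical point -/

/-- **The space-time record inequality (critical form).** Classical solution on `S` (as in §0), `t ∈ S`, `|e| = 1`,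
`x` a critical point of `y ↦ q(t,y,e)`, and the strain number TIME-CRITICAL at `(x,e)`: `(T − t)·∂ₜq(t,x,e) = q(t,x,e)`
(`∂ₜ` the frame's one-sided derivative).  Then, with `N = (T − t)·q`:
`N + N² − ν(T − t)²·Δ_x q(t,·,e)(x) ≤ (T − t)²·H(t,x,e)`.  Proof: F_S (§0) + E1_S⁺ (`strainGrowthViscous_holds`) give
`∂ₜq ≤ −q² + H + νΔq` at the critical point; multiply by `(T − t)² ≥ 0` and use the time-critical relation. [folklore] -/
theorem spacetime_record_inequality {ν T : ℝ} {S : Set ℝ}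
    {u : ℝ → (EuclideanSpace ℝ (Fin 3)) → (EuclideanSpace ℝ (Fin 3))} {p : ℝ → (EuclideanSpace ℝ (Fin 3)) → ℝ}
    (hS : UniqueDiffOn ℝ S) (hcl : S ⊆ closure (interior S)) (hsol : IsClassicalNSSolutionOn S ν 0 u p)
    {t : ℝ} (ht : t ∈ S) {x e : EuclideanSpace ℝ (Fin 3)} (he : ‖e‖ = 1)
    (hcrit : fderiv ℝ (fun y => strainQuad u t y e) x = 0)
    (htime : (T - t) * ⟪timeDerivWithin S (fun s y => fderiv ℝ (u s) y e) t x, e⟫ = strainQuad u t x e) :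
    (T - t) * strainQuad u t x e + ((T - t) * strainQuad u t x e) ^ 2
        - ν * (T - t) ^ 2 * strainLap u t x e ≤ (T - t) ^ 2 * strainFeed u p t x e := by
  have hu : ContDiff ℝ ∞ (u t) := hsol.smooth_velocity.contDiff_slice ht
  have hframe := strainFrame_on hS hcl hsol ht x e
  have hcrit' : fderiv ℝ (fun y => ⟪fderiv ℝ (u t) y e, e⟫) x = 0 := hcrit
  have hE := strainGrowthViscous_holds ν (u t) (p t) hu x e he hcrit' _ hframe
  obtain ⟨R, hRdef⟩ : ∃ R : ℝ, R = ⟪timeDerivWithin S (fun s y => fderiv ℝ (u s) y e) t x, e⟫ := ⟨_, rfl⟩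
  rw [← hRdef] at hE htime
  have hE' : R ≤ -(strainQuad u t x e) ^ 2 + strainFeed u p t x e + ν * strainLap u t x e := by
    unfold strainLap strainFeed pressureHess strainQuad
    linarith [hE]
  have hsq : 0 ≤ (T - t) ^ 2 := sq_nonneg _
  have h1 : (T - t) ^ 2 * R = (T - t) * strainQuad u t x e := by rw [sq, mul_assoc, htime]
  have h2 := mul_le_mul_of_nonneg_left hE' hsq
  nlinarith [h1, h2]

/-- **One-sided critical form.** Same, with the time-critical relation weakened to the RECORD side
`q(t,x,e) ≤ (T − t)·∂ₜq(t,x,e)` and `t ≤ T`: the conclusion is unchanged. [folklore] -/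
theorem spacetime_record_inequality_of_le {ν T : ℝ} {S : Set ℝ}
    {u : ℝ → (EuclideanSpace ℝ (Fin 3)) → (EuclideanSpace ℝ (Fin 3))} {p : ℝ → (EuclideanSpace ℝ (Fin 3)) → ℝ}
    (hS : UniqueDiffOn ℝ S) (hcl : S ⊆ closure (interior S)) (hsol : IsClassicalNSSolutionOn S ν 0 u p)
    {t : ℝ} (ht : t ∈ S) (htT : t ≤ T) {x e : EuclideanSpace ℝ (Fin 3)} (he : ‖e‖ = 1)
    (hcrit : fderiv ℝ (fun y => strainQuad u t y e) x = 0)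
    (htime : strainQuad u t x e ≤ (T - t) * ⟪timeDerivWithin S (fun s y => fderiv ℝ (u s) y e) t x, e⟫) :
    (T - t) * strainQuad u t x e + ((T - t) * strainQuad u t x e) ^ 2
        - ν * (T - t) ^ 2 * strainLap u t x e ≤ (T - t) ^ 2 * strainFeed u p t x e := by
  have hu : ContDiff ℝ ∞ (u t) := hsol.smooth_velocity.contDiff_slice ht
  have hframe := strainFrame_on hS hcl hsol ht x e
  have hcrit' : fderiv ℝ (fun y => ⟪fderiv ℝ (u t) y e, e⟫) x = 0 := hcrit
  have hE := strainGrowthViscous_holds ν (u t) (p t) hu x e he hcrit' _ hframe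
  obtain ⟨R, hRdef⟩ : ∃ R : ℝ, R = ⟪timeDerivWithin S (fun s y => fderiv ℝ (u s) y e) t x, e⟫ := ⟨_, rfl⟩
  rw [← hRdef] at hE htime
  have hE' : R ≤ -(strainQuad u t x e) ^ 2 + strainFeed u p t x e + ν * strainLap u t x e := by
    unfold strainLap strainFeed pressureHess strainQuad
    linarith [hE]
  have hsq : 0 ≤ (T - t) ^ 2 := sq_nonneg _
  have hTt : 0 ≤ T - t := sub_nonneg.mpr htT
  have h1 : (T - t) * strainQuad u t x e ≤ (T - t) ^ 2 * R := by
    have := mul_le_mul_of_nonneg_left htime hTt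
    rw [sq, mul_assoc]
    exact this
  have h2 := mul_le_mul_of_nonneg_left hE' hsq
  nlinarith [h1, h2]

/-! ## §2 Time-differentiability of the strain form and Fermat for the strain number -/

/-- The strain form `s ↦ q(s,x,e)` of a jointly smooth field has, within the time set `S` (unique differentiability),
the one-sided derivative `⟪∂ₜ(∇u e)(t,x), e⟫` (= the lane's `strainRate` when `S = [0,T)`). [folklore] -/
theorem hasDerivWithinAt_strainQuad {S : Set ℝ} {u : ℝ → (EuclideanSpace ℝ (Fin 3)) → (EuclideanSpace ℝ (Fin 3))}
    (h : IsSmoothSpaceTimeOn S u) (hS : UniqueDiffOn ℝ S) {t : ℝ} (ht : t ∈ S) (x e : EuclideanSpace ℝ (Fin 3)) :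
    HasDerivWithinAt (fun s => strainQuad u s x e)
      ⟪timeDerivWithin S (fun s y => fderiv ℝ (u s) y e) t x, e⟫ S t := by
  have hG : IsSmoothSpaceTimeOn S (fun s y => fderiv ℝ (u s) y e) := h.fderiv_slice_apply hS e
  have h1 : HasDerivWithinAt (fun s => fderiv ℝ (u s) x e)
      (timeDerivWithin S (fun s y => fderiv ℝ (u s) y e) t x) S t := by
    rw [timeDerivWithin_apply]
    exact (hG.differentiableWithinAt_time ht x).hasDerivWithinAt
  have h2 := h1.inner ℝ (hasDerivWithinAt_const t S e)
  simpa [strainQuad] using h2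

/-- **Fermat in time for the strain number.** If `S ∈ 𝓝 t` (an interior time) and `s ↦ (T − s)·q(s,x,e)` has a local
maximum at `t`, then `(T − t)·∂ₜq(t,x,e) = q(t,x,e)`. [folklore] -/
theorem strainNumber_fermat {S : Set ℝ} {u : ℝ → (EuclideanSpace ℝ (Fin 3)) → (EuclideanSpace ℝ (Fin 3))}
    (h : IsSmoothSpaceTimeOn S u) (hS : UniqueDiffOn ℝ S) {t : ℝ} (ht : S ∈ 𝓝 t)
    (x e : EuclideanSpace ℝ (Fin 3)) (T : ℝ)
    (hmax : IsLocalMax (fun s => (T - s) * strainQuad u s x e) t) :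
    (T - t) * ⟪timeDerivWithin S (fun s y => fderiv ℝ (u s) y e) t x, e⟫ = strainQuad u t x e := by
  have ht' : t ∈ S := mem_of_mem_nhds ht
  obtain ⟨R, hRdef⟩ : ∃ R : ℝ, R = ⟪timeDerivWithin S (fun s y => fderiv ℝ (u s) y e) t x, e⟫ := ⟨_, rfl⟩
  have hq : HasDerivAt (fun s => strainQuad u s x e) R t := by
    rw [hRdef]
    exact (hasDerivWithinAt_strainQuad h hS ht' x e).hasDerivAt ht
  have hl : HasDerivAt (fun s : ℝ => T - s) (-1) t := by
    simpa using (hasDerivAt_id t).const_sub T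
  have hprod := hl.mul hq
  have h0 := hmax.hasDerivAt_eq_zero hprod
  rw [← hRdef]
  linarith [h0]

/-- **One-sided Fermat.** A real function with a derivative at `t` that has a LEFT local maximum at `t`
(`f(s) ≤ f(t)` for `s ≤ t` near `t`: a running record) has nonnegative derivative there (Mathlib's Fermat
inequality on the positive tangent cone of `(−∞,t]`, direction `−1`). [folklore] -/
theorem hasDerivAt_nonneg_of_isLocalMaxOn_Iic {f : ℝ → ℝ} {f' t : ℝ} (hrec : IsLocalMaxOn f (Iic t) t)
    (hf : HasDerivAt f f' t) : 0 ≤ f' := by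
  have hy : (-1 : ℝ) ∈ posTangentConeAt (Iic t) t := by
    apply mem_posTangentConeAt_of_segment_subset
    intro z hz
    rw [segment_eq_uIcc, mem_uIcc] at hz
    show z ≤ t
    rcases hz with ⟨_, h2⟩ | ⟨h1, _⟩ <;> linarith
  have h := hrec.hasFDerivWithinAt_nonpos hf.hasFDerivAt.hasFDerivWithinAt hy
  rw [ContinuousLinearMap.toSpanSingleton_apply, smul_eq_mul] at h
  linarith

/-- **Fermat in time at a running record.** If `S ∈ 𝓝 t` and `s ↦ (T − s)·q(s,x,e)` has a LEFT local maximum at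
`t` (its value at `t` dominates its recent past), then `q(t,x,e) ≤ (T − t)·∂ₜq(t,x,e)`. [folklore] -/
theorem strainNumber_fermat_left {S : Set ℝ} {u : ℝ → (EuclideanSpace ℝ (Fin 3)) → (EuclideanSpace ℝ (Fin 3))}
    (h : IsSmoothSpaceTimeOn S u) (hS : UniqueDiffOn ℝ S) {t : ℝ} (ht : S ∈ 𝓝 t)
    (x e : EuclideanSpace ℝ (Fin 3)) (T : ℝ)
    (hrec : IsLocalMaxOn (fun s => (T - s) * strainQuad u s x e) (Iic t) t) :
    strainQuad u t x e ≤ (T - t) * ⟪timeDerivWithin S (fun s y => fderiv ℝ (u s) y e) t x, e⟫ := by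
  have ht' : t ∈ S := mem_of_mem_nhds ht
  obtain ⟨R, hRdef⟩ : ∃ R : ℝ, R = ⟪timeDerivWithin S (fun s y => fderiv ℝ (u s) y e) t x, e⟫ := ⟨_, rfl⟩
  have hq : HasDerivAt (fun s => strainQuad u s x e) R t := by
    rw [hRdef]
    exact (hasDerivWithinAt_strainQuad h hS ht' x e).hasDerivAt ht
  have hl : HasDerivAt (fun s : ℝ => T - s) (-1) t := by
    simpa using (hasDerivAt_id t).const_sub T
  have hprod := hl.mul hq
  have h0 := hasDerivAt_nonneg_of_isLocalMaxOn_Iic hrec hprod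
  rw [← hRdef]
  linarith [h0]

/-! ## §3 ★ The space-time record law -/

/-- ★ **THE SPACE-TIME RECORD LAW** («the strain number cannot peak cheaply»).  Classical solution `(u,p)` of
Navier–Stokes (`ν ≥ 0`) on a time set `S` (unique differentiability, `S ⊆ closure (interior S)`), an INTERIOR time
`t` (`S ∈ 𝓝 t`), a unit direction `e`, a point `x`, and any reference time `T`.  If `x` is a spatial maximum of
`y ↦ q(t,y,e) = ⟪∇u(t,y)e,e⟫` and `t` is a local maximum in time of the strain number `s ↦ (T − s)·q(s,x,e)`, then with
`N = (T − t)·q(t,x,e)` and `H = ¼(|ω|² − ⟪ω,e⟫²) − ∇²p(e,e)` at `(t,x)`: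

`N + N² ≤ (T − t)²·H`.

Door D12's defect–lifespan law (`defect_lifespan_law`, ROUND-50: `(c − 1)·Λ₀·e^β·(T − t₀) ≥ 1`) at a space-time record,
with constant exactly `1`, no budget, no `e^β`, no finite-energy frame, no decay hypothesis.  Inputs: F_S (§0),
E1_S⁺ (`strainGrowthViscous_holds`), the second-order condition `Δ_x q ≤ 0` at a spatial maximum
(`inner_fderiv_laplacian_le_zero_of_isMax`), Fermat in time (§2). [folklore] -/
theorem spacetime_record_law {ν T : ℝ} {S : Set ℝ}
    {u : ℝ → (EuclideanSpace ℝ (Fin 3)) → (EuclideanSpace ℝ (Fin 3))} {p : ℝ → (EuclideanSpace ℝ (Fin 3)) → ℝ}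
    (hν : 0 ≤ ν) (hS : UniqueDiffOn ℝ S) (hcl : S ⊆ closure (interior S))
    (hsol : IsClassicalNSSolutionOn S ν 0 u p)
    {t : ℝ} (ht : S ∈ 𝓝 t) {x e : EuclideanSpace ℝ (Fin 3)} (he : ‖e‖ = 1)
    (hmaxX : ∀ y, strainQuad u t y e ≤ strainQuad u t x e)
    (hmaxT : IsLocalMax (fun s => (T - s) * strainQuad u s x e) t) :
    (T - t) * strainQuad u t x e + ((T - t) * strainQuad u t x e) ^ 2 ≤ (T - t) ^ 2 * strainFeed u p t x e := by
  have ht' : t ∈ S := mem_of_mem_nhds ht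
  have hu : ContDiff ℝ ∞ (u t) := hsol.smooth_velocity.contDiff_slice ht'
  have hloc : IsLocalMax (fun y => strainQuad u t y e) x := Filter.Eventually.of_forall fun y => hmaxX y
  have hcrit : fderiv ℝ (fun y => strainQuad u t y e) x = 0 := hloc.fderiv_eq_zero
  have htime := strainNumber_fermat hsol.smooth_velocity hS ht x e T hmaxT
  have h := spacetime_record_inequality hS hcl hsol ht' he hcrit htime
  have hmaxX' : ∀ y, ⟪fderiv ℝ (u t) y e, e⟫ ≤ ⟪fderiv ℝ (u t) x e, e⟫ := hmaxX
  have h1 := inner_fderiv_laplacian_le_zero_of_isMax hu x e hmaxX'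
  rw [inner_fderiv_laplacian_eq_laplacian_strain hu x e] at h1
  have h1' : strainLap u t x e ≤ 0 := h1
  have h3 : ν * (T - t) ^ 2 * strainLap u t x e ≤ 0 :=
    mul_nonpos_of_nonneg_of_nonpos (mul_nonneg hν (sq_nonneg _)) h1'
  linarith

/-- ★ **THE SPACE-TIME DEFECT LAW** (`spacetime_record_law` in D12's normalisation).  Under the same hypotheses with
`t < T` and `q(t,x,e) > 0`: the record defect times the strain number is at least one,
`((H − q²)/q²)·((T − t)·q) ≥ 1`.  Compare `lerayProfile_defect_law` (ROUND-51: Leray profiles, `N = q_U/2a`) and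
`linearStrain_defect_number_eq_one` (the linear strain blow-up: `= 1` identically). [folklore] -/
theorem spacetime_defect_law {ν T : ℝ} {S : Set ℝ}
    {u : ℝ → (EuclideanSpace ℝ (Fin 3)) → (EuclideanSpace ℝ (Fin 3))} {p : ℝ → (EuclideanSpace ℝ (Fin 3)) → ℝ}
    (hν : 0 ≤ ν) (hS : UniqueDiffOn ℝ S) (hcl : S ⊆ closure (interior S))
    (hsol : IsClassicalNSSolutionOn S ν 0 u p)
    {t : ℝ} (ht : S ∈ 𝓝 t) (htT : t < T) {x e : EuclideanSpace ℝ (Fin 3)} (he : ‖e‖ = 1)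
    (hmaxX : ∀ y, strainQuad u t y e ≤ strainQuad u t x e)
    (hmaxT : IsLocalMax (fun s => (T - s) * strainQuad u s x e) t)
    (hq : 0 < strainQuad u t x e) :
    1 ≤ (strainFeed u p t x e - (strainQuad u t x e) ^ 2) / (strainQuad u t x e) ^ 2
          * ((T - t) * strainQuad u t x e) := by
  have h := spacetime_record_law hν hS hcl hsol ht he hmaxX hmaxT
  obtain ⟨q, hqdef⟩ : ∃ q : ℝ, q = strainQuad u t x e := ⟨_, rfl⟩
  obtain ⟨H, hHdef⟩ : ∃ H : ℝ, H = strainFeed u p t x e := ⟨_, rfl⟩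
  rw [← hqdef, ← hHdef] at h ⊢
  rw [← hqdef] at hq
  have hTt : 0 < T - t := sub_pos.mpr htT
  have key : q ≤ (T - t) * (H - q ^ 2) := by
    have e1 : (T - t) * (q - (T - t) * (H - q ^ 2)) = (T - t) * q + ((T - t) * q) ^ 2 - (T - t) ^ 2 * H := by
      ring
    have e2 : (T - t) * (q - (T - t) * (H - q ^ 2)) ≤ 0 := by rw [e1]; linarith
    by_contra hneg
    push Not at hneg
    have : 0 < (T - t) * (q - (T - t) * (H - q ^ 2)) := mul_pos hTt (by linarith)
    linarith
  have heq : (H - q ^ 2) / q ^ 2 * ((T - t) * q) = ((T - t) * (H - q ^ 2)) / q := by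
    field_simp
  rw [heq]
  calc (1 : ℝ) = q / q := (div_self hq.ne').symm
    _ ≤ ((T - t) * (H - q ^ 2)) / q := div_le_div_of_nonneg_right key hq.le

/-- ★★ **THE RUNNING-RECORD LAW** («every new high of the strain number is expensive»).  Classical solution on `S`
(as above, `ν ≥ 0`), an interior time `t < T`, a unit `e`, a point `x`.  Suppose the strain number density at
`(t,x,e)` DOMINATES ITS RECENT PAST: for all times `s ≤ t` close to `t`, all `y` and all unit `e'`,
`(T − s)·q(s,y,e') ≤ (T − t)·q(t,x,e)` (a running record — in particular every new all-time high of
`(T − t)·Λ(t)` attained in space).  Then `N + N² ≤ (T − t)²·H(t,x,e)`, `N = (T − t)·q(t,x,e)`.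
Only ONE-SIDED information in time is used (one-sided Fermat, §2), so — unlike an interior peak — running records are
what a blow-up whose strain number rises to its supremum MUST keep producing (`strainNumber_records`, §4). [folklore] -/
theorem running_record_law {ν T : ℝ} {S : Set ℝ}
    {u : ℝ → (EuclideanSpace ℝ (Fin 3)) → (EuclideanSpace ℝ (Fin 3))} {p : ℝ → (EuclideanSpace ℝ (Fin 3)) → ℝ}
    (hν : 0 ≤ ν) (hS : UniqueDiffOn ℝ S) (hcl : S ⊆ closure (interior S))
    (hsol : IsClassicalNSSolutionOn S ν 0 u p)
    {t : ℝ} (ht : S ∈ 𝓝 t) (htT : t < T) {x e : EuclideanSpace ℝ (Fin 3)} (he : ‖e‖ = 1)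
    (hrec : ∀ᶠ s in 𝓝[≤] t, ∀ (y e' : EuclideanSpace ℝ (Fin 3)), ‖e'‖ = 1 →
      (T - s) * strainQuad u s y e' ≤ (T - t) * strainQuad u t x e) :
    (T - t) * strainQuad u t x e + ((T - t) * strainQuad u t x e) ^ 2 ≤ (T - t) ^ 2 * strainFeed u p t x e := by
  have ht' : t ∈ S := mem_of_mem_nhds ht
  have hTt : 0 < T - t := sub_pos.mpr htT
  have hu : ContDiff ℝ ∞ (u t) := hsol.smooth_velocity.contDiff_slice ht'
  have hnow := hrec.self_of_nhdsWithin (mem_Iic.mpr le_rfl)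
  have hmaxX : ∀ y, strainQuad u t y e ≤ strainQuad u t x e := fun y =>
    le_of_mul_le_mul_left (hnow y e he) hTt
  have hloc : IsLocalMax (fun y => strainQuad u t y e) x := Filter.Eventually.of_forall fun y => hmaxX y
  have hcrit : fderiv ℝ (fun y => strainQuad u t y e) x = 0 := hloc.fderiv_eq_zero
  have hrec' : IsLocalMaxOn (fun s => (T - s) * strainQuad u s x e) (Iic t) t := by
    show ∀ᶠ s in 𝓝[Iic t] t, (T - s) * strainQuad u s x e ≤ (T - t) * strainQuad u t x e
    filter_upwards [hrec] with s hs
    exact hs x e he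
  have htime := strainNumber_fermat_left hsol.smooth_velocity hS ht x e T hrec'
  have h := spacetime_record_inequality_of_le hS hcl hsol ht' htT.le he hcrit htime
  have hmaxX' : ∀ y, ⟪fderiv ℝ (u t) y e, e⟫ ≤ ⟪fderiv ℝ (u t) x e, e⟫ := hmaxX
  have h1 := inner_fderiv_laplacian_le_zero_of_isMax hu x e hmaxX'
  rw [inner_fderiv_laplacian_eq_laplacian_strain hu x e] at h1
  have h1' : strainLap u t x e ≤ 0 := h1
  have h3 : ν * (T - t) ^ 2 * strainLap u t x e ≤ 0 :=
    mul_nonpos_of_nonneg_of_nonpos (mul_nonneg hν (sq_nonneg _)) h1'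
  linarith

/-- ★★ **THE RUNNING-RECORD DEFECT LAW**: at a running record with `q(t,x,e) > 0`, the record defect times the strain
number is at least one: `((H − q²)/q²)·((T − t)·q) ≥ 1`. [folklore] -/
theorem running_record_defect_law {ν T : ℝ} {S : Set ℝ}
    {u : ℝ → (EuclideanSpace ℝ (Fin 3)) → (EuclideanSpace ℝ (Fin 3))} {p : ℝ → (EuclideanSpace ℝ (Fin 3)) → ℝ}
    (hν : 0 ≤ ν) (hS : UniqueDiffOn ℝ S) (hcl : S ⊆ closure (interior S))
    (hsol : IsClassicalNSSolutionOn S ν 0 u p)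
    {t : ℝ} (ht : S ∈ 𝓝 t) (htT : t < T) {x e : EuclideanSpace ℝ (Fin 3)} (he : ‖e‖ = 1)
    (hrec : ∀ᶠ s in 𝓝[≤] t, ∀ (y e' : EuclideanSpace ℝ (Fin 3)), ‖e'‖ = 1 →
      (T - s) * strainQuad u s y e' ≤ (T - t) * strainQuad u t x e)
    (hq : 0 < strainQuad u t x e) :
    1 ≤ (strainFeed u p t x e - (strainQuad u t x e) ^ 2) / (strainQuad u t x e) ^ 2
          * ((T - t) * strainQuad u t x e) := by
  have h := running_record_law hν hS hcl hsol ht htT he hrec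
  obtain ⟨q, hqdef⟩ : ∃ q : ℝ, q = strainQuad u t x e := ⟨_, rfl⟩
  obtain ⟨H, hHdef⟩ : ∃ H : ℝ, H = strainFeed u p t x e := ⟨_, rfl⟩
  rw [← hqdef, ← hHdef] at h ⊢
  rw [← hqdef] at hq
  have hTt : 0 < T - t := sub_pos.mpr htT
  have key : q ≤ (T - t) * (H - q ^ 2) := by
    have e1 : (T - t) * (q - (T - t) * (H - q ^ 2)) = (T - t) * q + ((T - t) * q) ^ 2 - (T - t) ^ 2 * H := by
      ring
    have e2 : (T - t) * (q - (T - t) * (H - q ^ 2)) ≤ 0 := by rw [e1]; linarith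
    by_contra hneg
    push Not at hneg
    have : 0 < (T - t) * (q - (T - t) * (H - q ^ 2)) := mul_pos hTt (by linarith)
    linarith
  have heq : (H - q ^ 2) / q ^ 2 * ((T - t) * q) = ((T - t) * (H - q ^ 2)) / q := by
    field_simp
  rw [heq]
  calc (1 : ℝ) = q / q := (div_self hq.ne').symm
    _ ≤ ((T - t) * (H - q ^ 2)) / q := div_le_div_of_nonneg_right key hq.le

/-- The lane's frame `S = [0,T')`, interior time `0 < t < T'`, in the lane's vocabulary (`strainRate`): the
time-critical relation from a local maximum in time of the strain number. [folklore] -/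
theorem strainNumber_fermat_Ico {T' T : ℝ} {u : ℝ → (EuclideanSpace ℝ (Fin 3)) → (EuclideanSpace ℝ (Fin 3))}
    (h : IsSmoothSpaceTimeOn (Ico 0 T') u) {t : ℝ} (ht0 : 0 < t) (htT : t < T')
    (x e : EuclideanSpace ℝ (Fin 3))
    (hmax : IsLocalMax (fun s => (T - s) * strainQuad u s x e) t) :
    (T - t) * strainRate T' u t x e = strainQuad u t x e := by
  have hnhds : Ico 0 T' ∈ 𝓝 t := Ico_mem_nhds ht0 htT
  exact strainNumber_fermat h (uniqueDiffOn_Ico 0 T') hnhds x e T hmax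

/-- ★ The space-time record law IN THE LANE'S FRAME `[0,T')` with reference time the frame's end `T'` (the putative
blow-up time): at a space-time record `(t,x,e)` with `0 < t < T'`, `N + N² ≤ (T' − t)²·H`. [folklore] -/
theorem spacetime_record_law_Ico {ν T' : ℝ}
    {u : ℝ → (EuclideanSpace ℝ (Fin 3)) → (EuclideanSpace ℝ (Fin 3))} {p : ℝ → (EuclideanSpace ℝ (Fin 3)) → ℝ}
    (hν : 0 ≤ ν) (hT' : 0 < T') (hsol : IsClassicalNSSolutionOn (Ico 0 T') ν 0 u p)
    {t : ℝ} (ht0 : 0 < t) (htT : t < T') {x e : EuclideanSpace ℝ (Fin 3)} (he : ‖e‖ = 1)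
    (hmaxX : ∀ y, strainQuad u t y e ≤ strainQuad u t x e)
    (hmaxT : IsLocalMax (fun s => (T' - s) * strainQuad u s x e) t) :
    (T' - t) * strainQuad u t x e + ((T' - t) * strainQuad u t x e) ^ 2 ≤ (T' - t) ^ 2 * strainFeed u p t x e := by
  have hcl : Ico 0 T' ⊆ closure (interior (Ico 0 T')) := by
    rw [interior_Ico, closure_Ioo hT'.ne]
    exact Ico_subset_Icc_self
  exact spacetime_record_law hν (uniqueDiffOn_Ico 0 T') hcl hsol (Ico_mem_nhds ht0 htT) he hmaxX hmaxT

end Summit.NavierStokesRegularity.NavierStokesRegularity.Theorems.StrainDoors
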